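import Summits.Ventures.LatticeQCDFlow.Scoring.SU2TorusPlaquetteCharacterIntegral
import HarnessLib

/-!
# SU(2) on the 2-torus: the Haar integral of a product of plaquette characters WITH ONE PLAQUETTE TRACE INSERTED TWICE

HONEST FRAMING: exact (Metropolis-corrected) sampling algorithms for lattice gauge theory;
figures of merit are autocorrelation/cost numbers at stated couplings and volumes; no
continuum-physics claim.

Venture `LatticeQCDFlow` (cell pub-lqcd), sub-topic `Scoring`; FANOUT row 5 (`s0-sun-a`), GEN-12.
NEW WORK of the cell (placement rule); towards the EXACT SECOND MOMENT `⟨(½ tr U_p)²⟩_{(ℤ/L)²,β}` of the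
plaquette (the variance of the plaquette estimator — the error-bar oracle behind 'plaquette within 2σ of
exact').  Applying GEN-10's insertion rule `a₀·χ_k = ½(χ_{k+1} + χ_{k−1})` twice at the same plaquette
`x₀` (`a₀² χ_k = ¼(χ_{k+2} + (1 + [k ≠ 0]) χ_k + [k ≥ 2] χ_{k−2})`):

* `su2a0_sq_mul_prod_su2Character` — pointwise, `a₀(U_{x₀})²·∏_x χ_{m_x}(U_x) =
  ½ a₀(U_{x₀})∏_x χ_{m⁺_x}(U_x) + ½[m_{x₀} ≠ 0] a₀(U_{x₀})∏_x χ_{m⁻_x}(U_x)`;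
* **`integral_su2a0_sq_mul_prod_su2Character_plaquettes`** — by
  `SU2TorusPlaquetteCharacterIntegral.integral_su2a0_mul_prod_su2Character_plaquettes`,
  `∫ a₀(U_{x₀})² ∏_x χ_{m_x}(U_x) dHaar^{⊗E} = ¼ I(m⁺⁺) + ¼(1 + [m_{x₀} ≠ 0]) I(m) + ¼ [m_{x₀} ∉ {0,1}] I(m⁻⁻)`,
  `I(m') = [m' constant]·((m'_0+1)^{L²})⁻¹`, `m^{±±} = m` off `x₀`, `m^{±±}_{x₀} = m_{x₀} ± 2`.

Elementary; nothing is cited; no `def`.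
-/

noncomputable section

open Real MeasureTheory Set Function Finset Polynomial.Chebyshev
open Literature.MathematicalPhysics.QuantumFieldTheory Literature.MathematicalPhysics.QuantumLattice
open Summit.Ventures.LatticeQCDFlow.Exactness

namespace Summit.Ventures.LatticeQCDFlow.Scoring

variable {L : ℕ} [NeZero L]

/-! ## §1. Inserting `a₀²`: pointwise -/

/-- **Inserting one plaquette trace twice**, pointwise: with `m^± = update m x₀ (m_{x₀} ± 1)`,
`a₀(U_{x₀})·(a₀(U_{x₀})·∏_x χ_{m_x}(U_x)) = ½·a₀(U_{x₀})∏_x χ_{m⁺_x}(U_x) + ½·[m_{x₀} ≠ 0]·a₀(U_{x₀})∏_x χ_{m⁻_x}(U_x)`. -/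
theorem su2a0_sq_mul_prod_su2Character {Ω : Type*} (t : Site 2 L → Ω → ℝ) (m : Site 2 L → ℕ)
    (x₀ : Site 2 L) (V : Ω) :
    t x₀ V * (t x₀ V * ∏ x : Site 2 L, (U ℝ (m x)).eval (t x V)) =
      (1 / 2) * (t x₀ V * ∏ x : Site 2 L, (U ℝ (update m x₀ (m x₀ + 1) x)).eval (t x V)) +
        (1 / 2) * (if m x₀ = 0 then 0 else
          t x₀ V * ∏ x : Site 2 L, (U ℝ (update m x₀ (m x₀ - 1) x)).eval (t x V)) := by
  rw [su2a0_mul_prod_su2Character t m x₀ V]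
  split_ifs <;> ring

/-! ## §2. The update bookkeeping -/

omit [NeZero L] in
/-- `(m⁺)⁺ = m⁺⁺`. -/
theorem update_succ_update_succ (m : Site 2 L → ℕ) (x₀ : Site 2 L) :
    update (update m x₀ (m x₀ + 1)) x₀ (update m x₀ (m x₀ + 1) x₀ + 1) = update m x₀ (m x₀ + 2) := by
  rw [update_self, update_idem]

omit [NeZero L] in
/-- `(m⁺)⁻ = m`. -/
theorem update_pred_update_succ (m : Site 2 L → ℕ) (x₀ : Site 2 L) :
    update (update m x₀ (m x₀ + 1)) x₀ (update m x₀ (m x₀ + 1) x₀ - 1) = m := by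
  rw [update_self, update_idem, Nat.add_sub_cancel, update_eq_self]

omit [NeZero L] in
/-- `(m⁻)⁺ = m` when `m_{x₀} ≠ 0`. -/
theorem update_succ_update_pred (m : Site 2 L → ℕ) (x₀ : Site 2 L) (h0 : m x₀ ≠ 0) :
    update (update m x₀ (m x₀ - 1)) x₀ (update m x₀ (m x₀ - 1) x₀ + 1) = m := by
  rw [update_self, update_idem, Nat.sub_add_cancel (Nat.one_le_iff_ne_zero.mpr h0), update_eq_self]

omit [NeZero L] in
/-- `(m⁻)⁻ = m⁻⁻`. -/
theorem update_pred_update_pred (m : Site 2 L → ℕ) (x₀ : Site 2 L) :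
    update (update m x₀ (m x₀ - 1)) x₀ (update m x₀ (m x₀ - 1) x₀ - 1) = update m x₀ (m x₀ - 2) := by
  rw [update_self, update_idem, Nat.sub_sub]

/-! ## §3. The twice-inserted character integral on the torus -/

/-- **THE TWICE-INSERTED CHARACTER INTEGRAL ON THE 2-TORUS.**  For `L ≥ 1`, `m : Λ → ℕ`, a plaquette `x₀`
and product Haar measure on the links of `(ℤ/L)²`:
`∫ a₀(U_{x₀})² ∏_x χ_{m_x}(U_x) dHaar^{⊗E} = ¼·I(m⁺⁺) + ¼·(1 + [m_{x₀} ≠ 0])·I(m) + ¼·[m_{x₀} ≥ 2]·I(m⁻⁻)`,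
`I(m') = [∀ x, m'_x = m'_0]·((m'_0+1)^{L²})⁻¹`, `m^{±±} = update m x₀ (m_{x₀} ± 2)`. -/
theorem integral_su2a0_sq_mul_prod_su2Character_plaquettes (m : Site 2 L → ℕ) (x₀ : Site 2 L) :
    ∫ V, su2a0 (plaquetteHolonomy V x₀ 0 1) * (su2a0 (plaquetteHolonomy V x₀ 0 1) *
        ∏ x : Site 2 L, (U ℝ (m x)).eval (su2a0 (plaquetteHolonomy V x 0 1)))
        ∂(Measure.pi fun _ : Edge 2 L => haarProbability (Matrix.specialUnitaryGroup (Fin 2) ℂ)) =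
      (1 / 4) * (if (∀ x, update m x₀ (m x₀ + 2) x = update m x₀ (m x₀ + 2) 0) then
          ((((update m x₀ (m x₀ + 2) 0 : ℝ) + 1) ^ (L ^ 2)))⁻¹ else 0) +
        (1 / 4) * (if m x₀ = 0 then 1 else 2) *
          (if (∀ x, m x = m 0) then ((((m 0 : ℝ) + 1) ^ (L ^ 2)))⁻¹ else 0) +
        (1 / 4) * (if m x₀ < 2 then 0 else
          if (∀ x, update m x₀ (m x₀ - 2) x = update m x₀ (m x₀ - 2) 0) then
            ((((update m x₀ (m x₀ - 2) 0 : ℝ) + 1) ^ (L ^ 2)))⁻¹ else 0) := by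
  simp_rw [su2a0_sq_mul_prod_su2Character (fun (x : Site 2 L)
    (V : GaugeConfig 2 L (Matrix.specialUnitaryGroup (Fin 2) ℂ)) => su2a0 (plaquetteHolonomy V x 0 1)) m x₀]
  have hi1 : Integrable (fun V : GaugeConfig 2 L (Matrix.specialUnitaryGroup (Fin 2) ℂ) =>
      su2a0 (plaquetteHolonomy V x₀ 0 1) *
        ∏ x : Site 2 L, (U ℝ (update m x₀ (m x₀ + 1) x)).eval (su2a0 (plaquetteHolonomy V x 0 1)))
      (Measure.pi fun _ : Edge 2 L => haarProbability (Matrix.specialUnitaryGroup (Fin 2) ℂ)) := by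
    refine integrable_pi_su2_of_continuous (ι := Edge 2 L) ?_
    refine Continuous.mul ?_ (continuous_prod_su2Character_plaquettes (update m x₀ (m x₀ + 1)))
    exact continuous_su2a0.comp (by unfold plaquetteHolonomy; fun_prop)
  by_cases h0 : m x₀ = 0
  · -- only the `m⁺` branch; `m⁺⁻ = m`, and `m x₀ < 2`
    simp_rw [if_pos h0, mul_zero, add_zero]
    rw [integral_const_mul,
      integral_su2a0_mul_prod_su2Character_plaquettes (update m x₀ (m x₀ + 1)) x₀,
      update_succ_update_succ, update_pred_update_succ]
    have hne : update m x₀ (m x₀ + 1) x₀ ≠ 0 := by rw [update_self]; omega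
    rw [if_neg hne, if_pos (show m x₀ < 2 by omega)]
    ring
  · simp_rw [if_neg h0]
    have hi2 : Integrable (fun V : GaugeConfig 2 L (Matrix.specialUnitaryGroup (Fin 2) ℂ) =>
        su2a0 (plaquetteHolonomy V x₀ 0 1) *
          ∏ x : Site 2 L, (U ℝ (update m x₀ (m x₀ - 1) x)).eval (su2a0 (plaquetteHolonomy V x 0 1)))
        (Measure.pi fun _ : Edge 2 L => haarProbability (Matrix.specialUnitaryGroup (Fin 2) ℂ)) := by
      refine integrable_pi_su2_of_continuous (ι := Edge 2 L) ?_
      refine Continuous.mul ?_ (continuous_prod_su2Character_plaquettes (update m x₀ (m x₀ - 1)))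
      exact continuous_su2a0.comp (by unfold plaquetteHolonomy; fun_prop)
    rw [integral_add (hi1.const_mul _) (hi2.const_mul _), integral_const_mul, integral_const_mul,
      integral_su2a0_mul_prod_su2Character_plaquettes (update m x₀ (m x₀ + 1)) x₀,
      integral_su2a0_mul_prod_su2Character_plaquettes (update m x₀ (m x₀ - 1)) x₀,
      update_succ_update_succ, update_pred_update_succ, update_succ_update_pred m x₀ h0,
      update_pred_update_pred]
    have hne : update m x₀ (m x₀ + 1) x₀ ≠ 0 := by rw [update_self]; omega
    rw [if_neg hne]
    by_cases h1 : m x₀ = 1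
    · have hz : update m x₀ (m x₀ - 1) x₀ = 0 := by rw [update_self, h1]
      rw [if_pos hz, if_pos (show m x₀ < 2 by omega)]
      ring
    · have hz : update m x₀ (m x₀ - 1) x₀ ≠ 0 := by rw [update_self]; omega
      rw [if_neg hz, if_neg (show ¬ m x₀ < 2 by omega)]
      ring

end Summit.Ventures.LatticeQCDFlow.Scoring
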